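/-
Copyright (c) 2026 the pub-hodgecm-mathlib formalisation cell (harness21).  Prover seat hodgecm-mathlib-LH10-p01 (g10): road «M6 ∕ F3 TOT-Λ BY OVER-ORDERS»
(LEAD T14-66; dealer LH4-plan (g8) WORD #77; F5 pen F0P3a-p04 (g30) SIG-F5 v1 §3 (O-1)), carve (c2) for F3-5 ∕ F5: the junction between the lattice-TREE currency
(`Valued`, `IsSelfDualLattice`, `mapGL`, `stdLattice`) of ★ (W1) `SelfDualLatticeFixOrderOnly` and the SPAN currency (`ValuativeRel`, `Λ(u) = 𝒪·(columns of u)`,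
`u ∈ U(σ,H)`) of the ★ torsor counts `CyclicSelfDualLatticeTorsor` ∕ `SelfDualCyclicOverOrderTorsor`; 2026-09-02.
-/
import Literature.NumberTheory.Automorphic.UnitaryLatticeTreeFixedCosetStrataDictionary   -- ★ `mapGL_stdLattice_eq_iff_mem_glInt`, `map_toLin'_mapGL_stdLattice_le_scaleLattice_iff`, the two-instance convention `[Valued] [ValuativeRel] [Compatible]`; brings ★ T1a `UnitaryLatticeTreeDefs` (`IsSelfDualLattice`, `mapGL`, `isVertexLattice_mapGL_iff`), ★ `FixedCosetsStableLattices` (`span_range_transpose_eq_iff`, `span_range_transpose_mul`, `span_range_transpose_le_one_iff`), ★ `ValuedFieldValuativeRelBridge` (`v_le_one_iff_mem_integer`), ★ `isSelfDualLattice_stdLattice_three_of_v`, ★ `exists_unitary_mapGL_stdLattice_eq_of_isSelfDualLattice_of_trace`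
import Literature.NumberTheory.Automorphic.UnitaryLatticeTreeTypeTwoParent                -- ★ `scaleLattice_one`
import HarnessLib

/-!
# Self-dual lattices in two currencies: `{M self-dual (tree), P M}` and `{Λ(u) : u ∈ U(σ,H), Q Λ}` have the same number of elements

Over a field `K` carrying COMPATIBLE `Valued K ℤᵐ⁰` and `ValuativeRel K` structures (the adic completions of the tree), two spellings of
"unimodular hermitian lattice" coexist in the tree:

* the lattice-TREE currency of ★ `UnitaryLatticeTreeDefs` ∕ ★ (W1) `SelfDualLatticeFixOrderOnly`: `M : Submodule (Valued.integer K) (Fin N → K)` with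
  `IsSelfDualLattice σ ϖ H M` (Gram matrix and `ϖ`·inverse integral, `|det| = 1`), acted on by `mapGL`;
* the SPAN currency of ★ `FixedCosetsStableLattices` ∕ ★ `CyclicSelfDualLatticeTorsor` ∕ ★ `SelfDualCyclicOverOrderTorsor`:
  `Λ : Submodule 𝒪[K] (Fin N → K)` (`𝒪[K]` the `ValuativeRel` integers) of the form `Λ(u) = span 𝒪 (range uᵀ)` (the columns of `u`) for some `u ∈ U(σ, H)`.

The two module types differ (the scalar subrings are equal, ★ `valuedInteger_eq_integer`, but not definitionally), so counts are moved across by an explicit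
bijection rather than a cast.  Main results:

* §1 `mapGL_stdLattice_eq_iff_span_range_transpose_eq`: `u·L₀ = u′·L₀ ↔ Λ(u) = Λ(u′)` (both `↔ u⁻¹u′ ∈ GL_N(𝒪)`);
  `map_toLin'_mapGL_stdLattice_le_iff_map_span_range_transpose_le`: `τ(u·L₀) ⊆ u·L₀ ↔ τΛ(u) ⊆ Λ(u)` (both `↔ u⁻¹τu` integral).
* §2 `ncard_image_eq_ncard_image_of_eq_iff` (abstract): two maps with the same fibres on `s` have equinumerous images.
* §3 `ncard_setOf_isSelfDualLattice_eq_ncard_setOf_span`: if `L₀ = 𝒪^N` is self-dual and `U(σ,H)` is transitive on self-dual lattices, then for predicates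
  `P`, `Q` with `P(u·L₀) ↔ Q(Λ(u))` on `U`, `#{M : self-dual, P M} = #{Λ : (∃ u ∈ U, Λ = Λ(u)), Q Λ}`; the `τ`-stable reading
  `ncard_setOf_isSelfDualLattice_map_le_eq_ncard_setOf_span_map_le` (the set of ★ (W1)'s `hT` on the left, the set of the ★ torsor counts on the right);
  and its datum-free specialisation at `J₀ = antidiag(1,1,1)`, `N = 3`, given a trace element `t + σt = 1`, `|t| ≤ 1` (★ `…_of_trace`; no `|2| = 1`):
  `ncard_setOf_isSelfDualLattice_map_le_eq_ncard_setOf_span_map_le_antidiagonal`.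

References: [Kottwitz1986BaseChangeUnits] R. E. Kottwitz, *Base change for unit elements of Hecke algebras*, Compositio Math. 60 (1986) 237–250, §1 pp. 240–241 (fixed cosets `=` stable
self-dual lattices); [Serre1980Trees] J.-P. Serre, *Trees*, Ch. II §1.1 (lattices `Λ(g)`, `Λ(g) = Λ(g′) ↔ g⁻¹g′ ∈ GL_N(𝒪)`); [BruhatTits1972] F. Bruhat, J. Tits,
*Groupes réductifs sur un corps local I*, Publ. Math. IHÉS 41 (1972), §10 (self-dual lattices as hyperspecial vertices); [Rogawski1990] J. Rogawski,
*Automorphic representations of unitary groups in three variables*, §4.9 p. 54 (the lattice count behind the unit orbital integrals).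
-/

set_option autoImplicit false

noncomputable section

open Matrix ValuativeRel Literature.NumberTheory.Automorphic Literature.NumberTheory.Automorphic.IntegralReduction Literature.GroupTheory.SpecificGroups
open Literature.NumberTheory.Automorphic.HermitianLattice Literature.NumberTheory.Automorphic.UnitaryGroup
open scoped Matrix MatrixGroups WithZero ValuativeRel

namespace Literature.NumberTheory.Automorphic.UnitaryLatticeTree

/-! ## §1 The dictionary `u·L₀ ↔ Λ(u)`: equal lattices, stable lattices -/

section Span

variable {F : Type*} [Field F] [ValuativeRel F] {n : ℕ}

/-- **`τ·Λ(g) ⊆ Λ(g) ↔ g⁻¹ τ g` is integral** (`Λ(g)` the `𝒪`-span of the columns of `g ∈ GL_n(F)`): `τΛ(g) = Λ(τg) = g·Λ(g⁻¹τg)` and `Λ(g) = g·Λ(1)`,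
`g` acting injectively on lattices. [cite: Serre1980Trees, Ch. II §1.1] [cite: Kottwitz1986BaseChangeUnits, §1 pp. 240–241] -/
theorem map_toLin'_span_range_transpose_le_iff (τ : Matrix (Fin n) (Fin n) F) (g : GL (Fin n) F) :
    (Submodule.span 𝒪[F] (Set.range ((g : Matrix (Fin n) (Fin n) F))ᵀ)).map ((Matrix.toLin' τ).restrictScalars 𝒪[F]) ≤
        Submodule.span 𝒪[F] (Set.range ((g : Matrix (Fin n) (Fin n) F))ᵀ) ↔
      ∀ i k, ((g : Matrix (Fin n) (Fin n) F)⁻¹ * τ * (g : Matrix (Fin n) (Fin n) F)) i k ∈ 𝒪[F] := by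
  have hg : IsUnit (g : Matrix (Fin n) (Fin n) F).det := Matrix.isUnits_det_units g
  have h1 : τ * (g : Matrix (Fin n) (Fin n) F) = (g : Matrix (Fin n) (Fin n) F) * ((g : Matrix (Fin n) (Fin n) F)⁻¹ * τ * (g : Matrix (Fin n) (Fin n) F)) := by
    rw [← Matrix.mul_assoc, ← Matrix.mul_assoc, Matrix.mul_nonsing_inv _ hg, Matrix.one_mul]
  have h2 : Submodule.span 𝒪[F] (Set.range ((g : Matrix (Fin n) (Fin n) F))ᵀ) =
      (Submodule.span 𝒪[F] (Set.range (1 : Matrix (Fin n) (Fin n) F)ᵀ)).map ((Matrix.toLin' (g : Matrix (Fin n) (Fin n) F)).restrictScalars 𝒪[F]) := by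
    rw [← span_range_transpose_mul, Matrix.mul_one]
  have hinj : Function.Injective ((Matrix.toLin' (g : Matrix (Fin n) (Fin n) F)).restrictScalars 𝒪[F]) := fun v w hvw => by
    have h := congrArg (fun x => ((g⁻¹ : GL (Fin n) F) : Matrix (Fin n) (Fin n) F) *ᵥ x) hvw
    simpa only [LinearMap.coe_restrictScalars, Matrix.toLin'_apply, Matrix.mulVec_mulVec, ← Units.val_mul, inv_mul_cancel,
      Units.val_one, Matrix.one_mulVec] using h
  rw [← span_range_transpose_mul, h1, span_range_transpose_mul (g : Matrix (Fin n) (Fin n) F)]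
  conv_lhs => rw [h2]
  rw [Submodule.map_le_map_iff_of_injective hinj, span_range_transpose_le_one_iff]

end Span

variable {K : Type*} [Field K] [Valued K ℤᵐ⁰] [ValuativeRel K] [(Valued.v : Valuation K ℤᵐ⁰).Compatible] {N : ℕ}

omit [ValuativeRel K] [(Valued.v : Valuation K ℤᵐ⁰).Compatible] in
/-- **`τ·(g·L₀) ⊆ g·L₀ ↔ |(g⁻¹ τ g)_{ik}| ≤ 1`** (the case `c = 1` of ★ `map_toLin'_mapGL_stdLattice_le_scaleLattice_iff`). [cite: Kottwitz1986BaseChangeUnits, §1 pp. 240–241]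
[cite: Serre1980Trees, Ch. II §1.1] -/
theorem map_toLin'_mapGL_stdLattice_le_iff (τ : Matrix (Fin N) (Fin N) K) (g : GL (Fin N) K) :
    (mapGL g (stdLattice K N)).map ((Matrix.toLin' τ).restrictScalars (Valued.integer K)) ≤ mapGL g (stdLattice K N) ↔
      ∀ i k, Valued.v ((((g : Matrix (Fin N) (Fin N) K))⁻¹ * τ * (g : Matrix (Fin N) (Fin N) K)) i k) ≤ 1 := by
  have h := map_toLin'_mapGL_stdLattice_le_scaleLattice_iff (one_ne_zero : (1 : K) ≠ 0) τ g
  rwa [scaleLattice_one, map_one] at h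

/-- **STABILITY IN BOTH CURRENCIES**: `τ·(g·L₀) ⊆ g·L₀` (tree) `↔ τ·Λ(g) ⊆ Λ(g)` (span) — both say `g⁻¹ τ g ∈ M_N(𝒪)`. [cite: Kottwitz1986BaseChangeUnits, §1 pp. 240–241] [cite: Serre1980Trees, Ch. II §1.1] -/
theorem map_toLin'_mapGL_stdLattice_le_iff_map_span_range_transpose_le (τ : Matrix (Fin N) (Fin N) K) (g : GL (Fin N) K) :
    (mapGL g (stdLattice K N)).map ((Matrix.toLin' τ).restrictScalars (Valued.integer K)) ≤ mapGL g (stdLattice K N) ↔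
      (Submodule.span 𝒪[K] (Set.range ((g : Matrix (Fin N) (Fin N) K))ᵀ)).map ((Matrix.toLin' τ).restrictScalars 𝒪[K]) ≤
        Submodule.span 𝒪[K] (Set.range ((g : Matrix (Fin N) (Fin N) K))ᵀ) := by
  rw [map_toLin'_mapGL_stdLattice_le_iff, map_toLin'_span_range_transpose_le_iff]
  exact forall_congr' fun i => forall_congr' fun k => v_le_one_iff_mem_integer _

/-- **EQUALITY IN BOTH CURRENCIES**: `g·L₀ = g′·L₀ ↔ Λ(g) = Λ(g′)` — both say `g⁻¹ g′ ∈ GL_N(𝒪)` (★ `mapGL_stdLattice_eq_iff_mem_glInt`, ★ `span_range_transpose_eq_iff`).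
[cite: Serre1980Trees, Ch. II §1.1] [cite: Kottwitz1986BaseChangeUnits, §1 pp. 240–241] -/
theorem mapGL_stdLattice_eq_iff_span_range_transpose_eq (g g' : GL (Fin N) K) :
    mapGL g (stdLattice K N) = mapGL g' (stdLattice K N) ↔
      Submodule.span 𝒪[K] (Set.range ((g : Matrix (Fin N) (Fin N) K))ᵀ) = Submodule.span 𝒪[K] (Set.range ((g' : Matrix (Fin N) (Fin N) K))ᵀ) := by
  rw [span_range_transpose_eq_iff, ← mapGL_stdLattice_eq_iff_mem_glInt, mapGL_mul]
  constructor
  · intro h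
    rw [← h, ← mapGL_mul, inv_mul_cancel, mapGL_one]
  · intro h
    conv_lhs => rw [← h, ← mapGL_mul, mul_inv_cancel, mapGL_one]

/-! ## §2 Two maps with the same fibres have equinumerous images -/

omit [Valued K ℤᵐ⁰] [ValuativeRel K] [(Valued.v : Valuation K ℤᵐ⁰).Compatible] in
/-- **Abstract count transport**: if `f a = f a′ ↔ g a = g a′` for `a, a′ ∈ s`, then `f '' s` and `g '' s` have the same `ncard` (the bijection `f a ↦ g a`).
[cite: Serre1980Trees, Ch. II §1.1] -/
theorem ncard_image_eq_ncard_image_of_eq_iff {α β γ : Type*} (s : Set α) (f : α → β) (g : α → γ)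
    (h : ∀ a ∈ s, ∀ a' ∈ s, (f a = f a' ↔ g a = g a')) : (f '' s).ncard = (g '' s).ncard := by
  classical
  refine Set.ncard_congr (fun b hb => g hb.choose) (fun b hb => ⟨hb.choose, hb.choose_spec.1, rfl⟩) ?_ ?_
  · intro b b' hb hb' hgg
    have hff : f hb.choose = f hb'.choose := (h _ hb.choose_spec.1 _ hb'.choose_spec.1).2 hgg
    rw [← hb.choose_spec.2, ← hb'.choose_spec.2, hff]
  · rintro c ⟨a, ha, rfl⟩
    have hb : f a ∈ f '' s := ⟨a, ha, rfl⟩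
    exact ⟨f a, hb, (h _ hb.choose_spec.1 _ ha).1 hb.choose_spec.2⟩

/-! ## §3 The counts agree -/

/-- **`#{M : M SELF-DUAL, P M} = #{Λ(u) : u ∈ U(σ,H), Q(Λ(u))}`** when `L₀ = 𝒪^N` is self-dual (`hL₀`), `U(σ,H)` is transitive on the self-dual lattices
(`htrans`), and the predicates agree along the dictionary (`hPQ : P(u·L₀) ↔ Q(Λ(u))` for `u ∈ U`): both sets are images of `{u ∈ U | P(u·L₀)}`, under
`u ↦ u·L₀` resp. `u ↦ Λ(u)`, two maps with the same fibres (§1). [cite: Kottwitz1986BaseChangeUnits, §1 pp. 240–241] [cite: BruhatTits1972, §10] [cite: Serre1980Trees, Ch. II §1.1]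
[cite: Rogawski1990, §4.9 p. 54] -/
theorem ncard_setOf_isSelfDualLattice_eq_ncard_setOf_span (σ : K →+* K) (ϖ : K) (H : Matrix (Fin N) (Fin N) K)
    (hL₀ : IsSelfDualLattice σ ϖ H (stdLattice K N))
    (htrans : ∀ M : Submodule (Valued.integer K) (Fin N → K), IsSelfDualLattice σ ϖ H M →
      ∃ u : ↥(unitaryGroupOfForm σ H), M = mapGL ((u : ↥(unitaryGroupOfForm σ H)) : GL (Fin N) K) (stdLattice K N))
    (P : Submodule (Valued.integer K) (Fin N → K) → Prop) (Q : Submodule 𝒪[K] (Fin N → K) → Prop)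
    (hPQ : ∀ u : GL (Fin N) K, u ∈ unitaryGroupOfForm σ H →
      (P (mapGL u (stdLattice K N)) ↔ Q (Submodule.span 𝒪[K] (Set.range ((u : Matrix (Fin N) (Fin N) K))ᵀ)))) :
    {M : Submodule (Valued.integer K) (Fin N → K) | IsSelfDualLattice σ ϖ H M ∧ P M}.ncard =
      {Λ : Submodule 𝒪[K] (Fin N → K) |
        (∃ u ∈ unitaryGroupOfForm σ H, Λ = Submodule.span 𝒪[K] (Set.range ((u : Matrix (Fin N) (Fin N) K))ᵀ)) ∧ Q Λ}.ncard := by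
  classical
  set A : Set (GL (Fin N) K) := {u | u ∈ unitaryGroupOfForm σ H ∧ P (mapGL u (stdLattice K N))} with hA
  have hL : {M : Submodule (Valued.integer K) (Fin N → K) | IsSelfDualLattice σ ϖ H M ∧ P M} =
      (fun u : GL (Fin N) K => mapGL u (stdLattice K N)) '' A := by
    ext M
    simp only [hA, Set.mem_image, Set.mem_setOf_eq]
    constructor
    · rintro ⟨hsd, hP⟩
      obtain ⟨u, rfl⟩ := htrans M hsd
      exact ⟨u, ⟨u.2, hP⟩, rfl⟩
    · rintro ⟨u, ⟨hu, hP⟩, rfl⟩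
      exact ⟨(isVertexLattice_mapGL_iff σ ϖ H ⟨u, hu⟩ (stdLattice K N)).2 hL₀, hP⟩
  have hR : {Λ : Submodule 𝒪[K] (Fin N → K) |
        (∃ u ∈ unitaryGroupOfForm σ H, Λ = Submodule.span 𝒪[K] (Set.range ((u : Matrix (Fin N) (Fin N) K))ᵀ)) ∧ Q Λ} =
      (fun u : GL (Fin N) K => Submodule.span 𝒪[K] (Set.range ((u : Matrix (Fin N) (Fin N) K))ᵀ)) '' A := by
    ext Λ
    simp only [hA, Set.mem_image, Set.mem_setOf_eq]
    constructor
    · rintro ⟨⟨u, hu, rfl⟩, hQ⟩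
      exact ⟨u, ⟨hu, (hPQ u hu).2 hQ⟩, rfl⟩
    · rintro ⟨u, ⟨hu, hP⟩, rfl⟩
      exact ⟨⟨u, hu, rfl⟩, (hPQ u hu).1 hP⟩
  rw [hL, hR]
  exact ncard_image_eq_ncard_image_of_eq_iff A _ _ fun u _ u' _ => mapGL_stdLattice_eq_iff_span_range_transpose_eq u u'

/-- **THE `τ`-STABLE READING** (the set of ★ (W1) `ncard_vertex_rowZero_eq_of_total`'s `hT` on the left, the set of the ★ torsor counts on the right):
`#{M : M self-dual, τM ⊆ M} = #{Λ : (∃ u ∈ U(σ,H), Λ = Λ(u)), τΛ ⊆ Λ}`, for ANY matrix `τ`. [cite: Kottwitz1986BaseChangeUnits, §1 pp. 240–241] [cite: Rogawski1990, §4.9 p. 54]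
[cite: BruhatTits1972, §10] -/
theorem ncard_setOf_isSelfDualLattice_map_le_eq_ncard_setOf_span_map_le (σ : K →+* K) (ϖ : K) (H : Matrix (Fin N) (Fin N) K)
    (hL₀ : IsSelfDualLattice σ ϖ H (stdLattice K N))
    (htrans : ∀ M : Submodule (Valued.integer K) (Fin N → K), IsSelfDualLattice σ ϖ H M →
      ∃ u : ↥(unitaryGroupOfForm σ H), M = mapGL ((u : ↥(unitaryGroupOfForm σ H)) : GL (Fin N) K) (stdLattice K N))
    (τ : Matrix (Fin N) (Fin N) K) :
    {M : Submodule (Valued.integer K) (Fin N → K) | IsSelfDualLattice σ ϖ H M ∧ M.map ((Matrix.toLin' τ).restrictScalars (Valued.integer K)) ≤ M}.ncard =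
      {Λ : Submodule 𝒪[K] (Fin N → K) |
        (∃ u ∈ unitaryGroupOfForm σ H, Λ = Submodule.span 𝒪[K] (Set.range ((u : Matrix (Fin N) (Fin N) K))ᵀ)) ∧
          Λ.map ((Matrix.toLin' τ).restrictScalars 𝒪[K]) ≤ Λ}.ncard :=
  ncard_setOf_isSelfDualLattice_eq_ncard_setOf_span σ ϖ H hL₀ htrans _ _ fun u _ => map_toLin'_mapGL_stdLattice_le_iff_map_span_range_transpose_le τ u

/-- **THE SAME AT `J₀ = antidiag(1,1,1)`, `N = 3`, DATUM-FREE** (no `|2| = 1`): for an isometric involution `σ`, a uniformiser `ϖ` and a trace element `t + σt = 1`,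
`|t| ≤ 1` (unramified `σ`: ★ `UnitaryGroup.exists_add_map_eq_one_integer`; tame: `t = ½`), the root is self-dual (★ `isSelfDualLattice_stdLattice_three_of_v`) and `U(σ,J₀)` is
transitive (★ `exists_unitary_mapGL_stdLattice_eq_of_isSelfDualLattice_of_trace`), so `#{M : M self-dual for J₀, τM ⊆ M} = #{Λ(u) : u ∈ U(σ,J₀), τΛ(u) ⊆ Λ(u)}` for every `τ`.
[cite: Kottwitz1986BaseChangeUnits, §1 pp. 240–241] [cite: Rogawski1990, §4.9 p. 54] [cite: Jacobowitz1962, §7] [cite: BruhatTits1972, §10] -/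
theorem ncard_setOf_isSelfDualLattice_map_le_eq_ncard_setOf_span_map_le_antidiagonal {σ : K →+* K} (hσ : ∀ a, σ (σ a) = a)
    (hvσ : ∀ a, Valued.v (σ a) = Valued.v a) {ϖ : K} (hϖ : Valued.v ϖ = WithZero.exp (-1 : ℤ)) (htrace : ∃ t : K, Valued.v t ≤ 1 ∧ t + σ t = 1)
    (τ : Matrix (Fin 3) (Fin 3) K) :
    {M : Submodule (Valued.integer K) (Fin 3 → K) | IsSelfDualLattice σ ϖ ((StdForm.antidiagonal 3).over K) M ∧
        M.map ((Matrix.toLin' τ).restrictScalars (Valued.integer K)) ≤ M}.ncard =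
      {Λ : Submodule 𝒪[K] (Fin 3 → K) |
        (∃ u ∈ unitaryGroupOfForm σ ((StdForm.antidiagonal 3).over K), Λ = Submodule.span 𝒪[K] (Set.range ((u : Matrix (Fin 3) (Fin 3) K))ᵀ)) ∧
          Λ.map ((Matrix.toLin' τ).restrictScalars 𝒪[K]) ≤ Λ}.ncard :=
  ncard_setOf_isSelfDualLattice_map_le_eq_ncard_setOf_span_map_le σ ϖ _ (isSelfDualLattice_stdLattice_three_of_v hϖ)
    (fun _ hM => by
      obtain ⟨u, hu⟩ := exists_unitary_mapGL_stdLattice_eq_of_isSelfDualLattice_of_trace hσ hvσ hϖ htrace hM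
      exact ⟨u, hu.symm⟩) τ

end Literature.NumberTheory.Automorphic.UnitaryLatticeTree

end
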